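import Summits.BirchSwinnertonDyer.BirchSwinnertonDyer.Theorems.SchneiderFreeAdditiveX3KYReadLogBridge
import Summits.BirchSwinnertonDyer.BirchSwinnertonDyer.Theorems.SchneiderFreeAdditiveX3TwistUntwistHeights
import Literature.NumberTheory.EllipticCurves.PadicLogFiniteExtensionVariableChangeNormedProofs
import HarnessLib
import HarnessLib.Audit.Tags

/-!
# Route `SchneiderFreeAdditiveX3` (K1 door), crux `GordTwoBranchIMC` (stmt-BirchSwinnertonDyer-19177):
# the TWIST DESCENT OF THE LOGARITHM for the value half `KYRead.KYReadCHValue` — PROVED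

Cell `bsd-schneider-ideate` (HOME `run/shared/lean/pub/bsd-schneider-ideate/`), seat `door-c3` gen 10.
PARTITION: board row B6 ∩ X3 ∩ sst-twist, r = 1, (G-ord, `e = 2`) half (2 560 of 7 101 pairs) of
`Rank1Residual.partition`; types-the-object-of / proves the descent step inside crux r3's last untyped
input (the value half of `stub_CH`); closes nothing (BSD is not advanced; the crux stays OPEN behind the
Keller–Yin PREPRINT claims and the Castella–Hsieh value formula, cite item wi-73260).

## What is proved
`KYRead.KYReadCHValue` (file `…KYReadHypsBranch.lean`) asks for `L(𝟙) = u · (log_{ω_W}(Q)/c′)²` with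
`u ∈ R₀`, where `W = C₂ • ((D • W') ⊗ χ_{p*})` is the door curve presented on its good partner `W'`
(minimal, good ordinary at `p`), `z = Σ_σ χ_ε(σ) y^σ ∈ W'(K[p])` the genus-twisted trace of a
conductor-`p` Heegner point and `Q ∈ W(K)` its DESCENT: `Q = ι_{C₂}(ι_θ⁻¹(ι_D z))` in `W(K[p])`,
`θ² = p*`. Castella–Hsieh's printed value (Math. Ann. 370 (2018) Thm. 5.7, (eq:bdp) in its proof; Lemma
5.4) is `𝓛(χ_ε)² = 𝔤(χ_{ε,𝔭})² · unit · (log_{ω_{W'}} z)²` with the logarithm over the RAMIFIED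
completion `K[p]_𝔓 ∋ θ` (tree: `padicLogPointFiniteExt`, p495646). This file proves the glue between the
two logarithms, for ARBITRARY rational changes `C₂`, `D` (the intermediate models `D • W'`,
`(D • W')^{(p*)}` need not be `p`-integral, so the comparison is done in ONE step along the composite
change `C₂ · ι_θ⁻¹ · D`, using gen 10's general change-of-variables rule for `log_ω`,
`Literature/…/PadicLogFiniteExtensionVariableChange{,Normed}Proofs.lean`, p502421/p503655):

* §1 `compositeChange_u/_smul`, `descendedPoint_eq_congrEquiv_pointMap` — over any field `L ∋ θ`:
  `W_L = (C₂ · ι_θ⁻¹ · D) • W'_L`, `u = u_{C₂} u_D θ⁻¹`, and the door's descended point IS `ι_{C₂·ι_θ⁻¹·D}`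
  applied to `z` (coordinates);
* §2 `logOmega_eq_padicLogPointFiniteExt` (the receptacle's `logOmega W p ι P` = the Literature
  `padicLogPointFiniteExt` over `ℚ_p` of `P_ι`), `map_logOmega_eq_padicLogPointFiniteExt` (read in any
  complete `F ⊇ ℚ_p` along an isometric `e`, with a multiple of the point in the level), integrality of the
  minimal models in `F`, `‖Δ_W‖ ≤ 1` / `= 1`;
* §3 **`padicLog_map_eq_mul_logOmega_of_descent`**: in any complete nonarchimedean `F ⊇ ℚ_p` (structure map
  `e` isometric — MEANT: `F = ℂ_p`, `e = algebraMap`, `PadicComplex.norm_extends'`), along `ι_p : K → ℚ_p`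
  and `j : L → F` with `j|_K = e ∘ ι_p`, for `p ∤ Δ_{W'}`:
  `log_{ω_{W'}}(j_* z) = j(θ) · (u_{C₂}u_D)⁻¹ · e(logOmega W p ι_p Q)`, and squared
  (`sq_padicLog_map_eq_of_descent`) `(log_{ω_{W'}} j_* z)² = p* · (u_{C₂}u_D)⁻² · e(log_{ω_W} Q)²`.
  The unit bookkeeping `|u_{C₂}u_D θ⁻¹| ≥ 1` comes from `Δ_W = u⁻¹²Δ_{W'}` with both models minimal and
  `p ∤ Δ_{W'}` (`one_le_val_u_of_smul_eq`) — so the door's `u` is `p*·(u_{C₂}u_D)⁻²·(CH's constant)`,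
  `p`-INTEGRAL as soon as CH's constant has valuation `≥ −1` (it is `𝔤(χ_{ε,𝔭})²·unit = p*·unit`).

WHY `F` GENERIC and not `ℂ_[p]`: statements written directly over `ℂ_[p] = Completion (AlgebraicClosure
ℚ_p)` make the kernel unfold its instance tower when compared with generic lemmas (kernel timeouts
observed at elaboration-clean files); consumers instantiate `F := ℂ_[p]` by `have h := … (F := ℂ_[p]) …`.

HONEST FRAMING: a theorem about logarithms of points under isomorphisms of Weierstrass models; it does not
touch the `p`-adic `L`-function, proves nothing printed by Castella–Hsieh or Keller–Yin, and does not
close the crux. Theses-free.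

References: Silverman *AEC* III.1 Table 3.1, Prop. III.3.1(b), IV.6.4, VII.1–2, X.5 Cor. 5.4;
Castella–Hsieh, Math. Ann. 370 (2018) Lemma 5.4, Thm. 5.7 (arXiv:1505.08165 pp. 17–19);
Keller–Yin arXiv:2410.23241 §3.4 (the branch `𝓛_ε`).
-/

noncomputable section

open scoped Classical NNReal

open WeierstrassCurve NumberField IsDedekindDomain Field
  Literature.NumberTheory.EllipticCurves
  Literature.NumberTheory.EllipticCurves.FormalGroupChart
  Summit.BirchSwinnertonDyer.Rank1Residual
  Summit.BirchSwinnertonDyer.Rank1Residual.X11b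
  Summit.BirchSwinnertonDyer.Rank1Residual.X11b.Halves

set_option linter.dupNamespace false
set_option autoImplicit false

namespace Summit.BirchSwinnertonDyer.BirchSwinnertonDyer.Theorems.SchneiderFree.KYRead.LogDescent

/-! ## §1 The composite change of variables `C₂ · ι_θ⁻¹ · D` (any field) -/

section Composite

variable {L : Type*} [Field L]

/-- `(congrEquiv h).symm = congrEquiv h.symm` pointwise. [folklore] -/
theorem congrEquiv_symm_apply {W₁ W₂ : WeierstrassCurve L} (h : W₁ = W₂) (P : W₂.toAffine.Point) :
    (Affine.Point.congrEquiv h).symm P = Affine.Point.congrEquiv h.symm P := by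
  subst h
  rfl

variable [Algebra ℚ L] (V : WeierstrassCurve ℚ) (D C₂ : VariableChange ℚ) [(D • V).IsCharNeTwoNF]
  (d : ℚ) {θ : L}

/-- `u(C₂ · ι_θ⁻¹ · D) = u_{C₂} u_D · θ⁻¹` for the composite change of variables over `L ∋ θ`.
[cite: SilvermanAEC2009, III.1 Table 3.1] -/
theorem compositeChange_u (hθ : θ ≠ 0) :
    ((C₂.map (algebraMap ℚ L) * ((untwistAt hθ)⁻¹ * D.map (algebraMap ℚ L))).u : L) =
      algebraMap ℚ L (C₂.u * D.u : ℚ) * θ⁻¹ := by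
  simp only [VariableChange.mul_def, VariableChange.inv_def, untwistAt,
    VariableChange.map_u, Units.val_mul, Units.val_inv_eq_inv_val, Units.val_mk0, Units.coe_map,
    MonoidHom.coe_coe, map_mul]
  ring

/-- The composite change `C₂ · ι_θ⁻¹ · D` (`θ² = d`) carries `V_L` to the door model:
`(C₂ · ι_θ⁻¹ · D) • V_L = (C₂ • (D • V)^{(d)})_L` (`(C • W)_L = C_L • W_L`, `ι_θ • (X^{(d)})_L = X_L`).
[cite: SilvermanAEC2009, X.5 Cor. 5.4] -/
theorem compositeChange_smul (hθ2 : θ ^ 2 = algebraMap ℚ L d) (hθ : θ ≠ 0) :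
    (C₂.map (algebraMap ℚ L) * ((untwistAt hθ)⁻¹ * D.map (algebraMap ℚ L))) • V.baseChange L =
      (C₂ • (D • V).quadraticTwist d).baseChange L := by
  rw [mul_smul, mul_smul, ← VariableChange.baseChange_smul_eq V D L,
    ← untwistAt_smul_eq (D • V) hθ2 hθ, inv_smul_smul, VariableChange.baseChange_smul_eq]

/-- **The door's descended point is the composite change applied to the point** (coordinates): for
`P ∈ V(L)`, `ι_{C₂}(ι_θ⁻¹(ι_D P)) = ι_{C₂ · ι_θ⁻¹ · D}(P)` read along `compositeChange_smul`.
[cite: SilvermanAEC2009, III.1 Table 3.1 and Prop. III.3.1(b)] -/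
theorem descendedPoint_eq_congrEquiv_pointMap (hθ2 : θ ^ 2 = algebraMap ℚ L d) (hθ : θ ≠ 0)
    (P : (V.baseChange L).toAffine.Point) :
    VariableChange.pointEquivBaseChange ((D • V).quadraticTwist d) C₂ L
        ((VariableChange.pointEquiv (((D • V).quadraticTwist d).baseChange L) (untwistAt hθ)).symm
          ((Affine.Point.congrEquiv (untwistAt_smul_eq (D • V) hθ2 hθ)).symm
            (VariableChange.pointEquivBaseChange V D L P))) =
      Affine.Point.congrEquiv (compositeChange_smul V D C₂ d hθ2 hθ)
        (VariableChange.pointMap (V.baseChange L)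
          (C₂.map (algebraMap ℚ L) * ((untwistAt hθ)⁻¹ * D.map (algebraMap ℚ L))) P) := by
  rcases P with _ | ⟨x, y, h⟩
  · simp only [← WeierstrassCurve.Affine.Point.zero_def, map_zero, VariableChange.pointMap_zero]
  · rw [VariableChange.pointEquivBaseChange_some, congrEquiv_symm_apply, Affine.Point.congrEquiv_some,
      VariableChange.pointEquiv_symm_apply, VariableChange.pointInv_some,
      VariableChange.pointEquivBaseChange_some, VariableChange.pointMap_some,
      Affine.Point.congrEquiv_some]
    have hu₂ : (algebraMap ℚ L (C₂.u : ℚ)) ≠ 0 := by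
      rw [map_ne_zero]; exact C₂.u.ne_zero
    have huD : (algebraMap ℚ L (D.u : ℚ)) ≠ 0 := by
      rw [map_ne_zero]; exact D.u.ne_zero
    simp only [WeierstrassCurve.Affine.Point.some.injEq, VariableChange.toX_def, VariableChange.toY_def,
      VariableChange.ofX_def, VariableChange.ofY_def, VariableChange.mul_def,
      VariableChange.inv_def, untwistAt, VariableChange.map_u, VariableChange.map_r,
      VariableChange.map_s, VariableChange.map_t, Units.val_mul, Units.val_inv_eq_inv_val,
      Units.val_mk0, Units.coe_map, MonoidHom.coe_coe]
    constructor
    · field_simp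
      ring
    · field_simp
      ring

end Composite

/-! ## §3 The twist descent of the logarithm -/

section Descent

variable (p : ℕ) [Fact p.Prime] (W' : WeierstrassCurve ℚ) [W'.IsGloballyMinimal]
  (D C₂ : VariableChange ℚ) [(D • W').IsCharNeTwoNF] (d : ℚ)
  [(C₂ • (D • W').quadraticTwist d).IsElliptic] [(C₂ • (D • W').quadraticTwist d).IsGloballyMinimal]
  {K : Type} [Field K] [NumberField K] {L : Type*} [Field L] [Algebra ℚ L] [Algebra K L]
  {F : Type} [NontriviallyNormedField F] [IsUltrametricDist F] [CompleteSpace F] [CharZero F]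

omit [(C₂ • (D • W').quadraticTwist d).IsElliptic] [(D • W').IsCharNeTwoNF] [CompleteSpace F] in
/-- **`|u| ≥ 1` for a change of variables between the two minimal models read in `F`**: if
`C • W'_F = W_F` with `W'`, `W` globally minimal over `ℚ` and `p ∤ Δ_{W'}`, then `|Δ_W| = |u|⁻¹²·|Δ_{W'}|
= |u|⁻¹² ≤ 1`, so `|u| ≥ 1`. [cite: SilvermanAEC2009, III.1 Table 3.1 (Δ' = u⁻¹²Δ) and VII.1] -/
theorem one_le_val_u_of_smul_eq (e : ℚ_[p] →+* F) (he : ∀ x, ‖e x‖ = ‖x‖) {C : VariableChange F}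
    (hCV : C • W'.baseChange F = (C₂ • (D • W').quadraticTwist d).baseChange F)
    (hΔ' : ¬ (p : ℤ) ∣ minimalDiscriminantInt W') : 1 ≤ NormedField.valuation (C.u : F) := by
  have hΔ : ((C₂ • (D • W').quadraticTwist d).baseChange F).Δ =
      ((C.u : F))⁻¹ ^ 12 * (W'.baseChange F).Δ := by
    rw [← hCV, WeierstrassCurve.variableChange_Δ, Units.val_inv_eq_inv_val]
  have h1 := (norm_Δ_baseChange p e he (C₂ • (D • W').quadraticTwist d)).1
  have h2 := (norm_Δ_baseChange p e he W').2 hΔ'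
  rw [hΔ, norm_mul, norm_pow, norm_inv, h2, mul_one] at h1
  rw [NormedField.valuation_apply, ← NNReal.coe_le_coe, coe_nnnorm, NNReal.coe_one]
  by_contra hlt
  have hlt' := lt_of_not_ge hlt
  have hpos : 0 < ‖(C.u : F)‖ := norm_pos_iff.mpr (Units.ne_zero _)
  have h3 := one_lt_pow₀ ((one_lt_inv₀ hpos).mpr hlt') (by norm_num : (12 : ℕ) ≠ 0)
  exact absurd h1 (not_le.mpr h3)

/-- **Twist descent of the `p`-adic logarithm (door data of `KYRead.KYReadCHValue`).** Let
`W = C₂ • ((D • W') ⊗ χ_d)` be the door curve presented on the good partner `W'` (`D`, `C₂` ARBITRARY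
rational changes of variables; on the door `d = p* = (−1)^{(p−1)/2} p`), `θ ∈ L` a square root of `d`
in a field `L ⊇ K`, `z ∈ W'(L)` and `Q ∈ W(K)` with `Q = ι_{C₂}(ι_θ⁻¹(ι_D z))` in `W(L)` (the descent
equation of the door: `z = Σ_σ χ_ε(σ) y^σ` the genus-twisted trace of a conductor-`p` Heegner point).
Then in ANY complete nonarchimedean field `F ⊇ ℚ_p` (structure map `e` isometric; e.g. `F = ℂ_p`),
along any `ι_p : K → ℚ_p`, `j : L → F` with `j|_K = e ∘ ι_p`, and provided `p ∤ Δ_{W'}`: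
`log_{ω_{W'}}(j_* z) = j(θ) · (u_{C₂} u_D)⁻¹ · e(log_{ω_W}(Q))` in `F`, where `log_{ω_W}(Q) =
logOmega W p ι_p Q ∈ ℚ_p` is the receptacle's logarithm and `log_{ω_{W'}}` is the `F`-valued
`padicLogPointFiniteExt` of the minimal model `W'`. Proof: `W_F = (C₂ · ι_{jθ}⁻¹ · D) • W'_F`
(`compositeChange_smul`) with `u = u_{C₂} u_D (jθ)⁻¹`, `|u|¹² = |Δ_{W'}|/|Δ_W| ≥ 1`, and the general
change-of-variables rule for `log_ω` (`padicLogPointFiniteExt_pointMap_of_variableChange_of_one_le`).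
Squared: `(log_{ω_{W'}} j_* z)² = d · (u_{C₂}u_D)⁻² · e(log_{ω_W} Q)²`, the descent of Castella–Hsieh's
`(log z_χ)²` to the door's `(log_{ω_W} Q)²` with the factor `p*`.
[cite: SilvermanAEC2009, III.1 Table 3.1 with Thm. IV.6.4 and X.5 Cor. 5.4]
[cite: CastellaHsieh2018, Thm. 5.7 (the logarithm of the twisted Heegner class over the ramified completion)] -/
theorem padicLog_map_eq_mul_logOmega_of_descent
    {θ : L} (hθ2 : θ ^ 2 = algebraMap ℚ L d) (hθ : θ ≠ 0)
    (z : (W'.baseChange L).toAffine.Point)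
    (Q : ((C₂ • (D • W').quadraticTwist d).baseChange K).toAffine.Point)
    (hQ : WeierstrassCurve.Affine.Point.map (algebraMap K L).toRatAlgHom Q =
      VariableChange.pointEquivBaseChange ((D • W').quadraticTwist d) C₂ L
        ((VariableChange.pointEquiv (((D • W').quadraticTwist d).baseChange L) (untwistAt hθ)).symm
          ((Affine.Point.congrEquiv (untwistAt_smul_eq (D • W') hθ2 hθ)).symm
            (VariableChange.pointEquivBaseChange W' D L z))))
    (ι_p : K →+* ℚ_[p]) (e : ℚ_[p] →+* F) (he : ∀ x, ‖e x‖ = ‖x‖) (j : L →+* F)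
    (hj : ∀ x : K, j (algebraMap K L x) = e (ι_p x))
    (hΔ' : ¬ (p : ℤ) ∣ minimalDiscriminantInt W') :
    haveI := isIntegral_valuation_baseChange W' F
    padicLogPointFiniteExt NormedField.valuation (W'.baseChange F) p
        (WeierstrassCurve.Affine.Point.map j.toRatAlgHom z) =
      j θ * (algebraMap ℚ F (C₂.u * D.u : ℚ))⁻¹ *
        e (logOmega (C₂ • (D • W').quadraticTwist d) p ι_p Q) := by
  haveI hintW' := isIntegral_valuation_baseChange W' F
  haveI hintW := isIntegral_valuation_baseChange (C₂ • (D • W').quadraticTwist d) F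
  obtain ⟨hp0', hp1'⟩ := natCast_ne_zero_and_val_lt_one_of_isometry p e he
  -- the square root of `d` in `F`
  have hj'app : ∀ x, j.toRatAlgHom x = j x := fun x ↦ rfl
  have hθ'2 : (j θ) ^ 2 = algebraMap ℚ F d := by
    rw [← map_pow, hθ2, ← hj'app, AlgHom.commutes]
  have hθ'0 : j θ ≠ 0 := (map_ne_zero j).mpr hθ
  -- the composite change of variables over `F` and the model equality
  have hCV := compositeChange_smul (L := F) W' D C₂ d hθ'2 hθ'0
  haveI hintC : ((C₂.map (algebraMap ℚ F) * ((untwistAt hθ'0)⁻¹ * D.map (algebraMap ℚ F))) •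
      W'.baseChange F).IsIntegral (NormedField.valuation (K := F)).integer := by
    rw [hCV]; exact hintW
  -- Step A: the descent equation read in `F`
  have hcomp : (j.toRatAlgHom).comp (algebraMap K L).toRatAlgHom =
      (e.toRatAlgHom).comp ι_p.toRatAlgHom := by
    apply AlgHom.ext
    intro x
    simp only [AlgHom.coe_comp, Function.comp_apply, RingHom.toRatAlgHom_apply]
    exact hj x
  have hjθ : j.toRatAlgHom θ = (((1 : ℤˣ) : ℤ) : F) * j θ := by
    rw [Units.val_one, Int.cast_one, one_mul]; rfl
  have hQC : WeierstrassCurve.Affine.Point.map e.toRatAlgHom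
      (X11b.padicPointOf (C₂ • (D • W').quadraticTwist d) p ι_p Q) =
      Affine.Point.congrEquiv hCV (VariableChange.pointMap (W'.baseChange F)
        (C₂.map (algebraMap ℚ F) * ((untwistAt hθ'0)⁻¹ * D.map (algebraMap ℚ F)))
        (WeierstrassCurve.Affine.Point.map j.toRatAlgHom z)) := by
    rw [X11b.padicPointOf, WeierstrassCurve.Affine.Point.map_map, ← hcomp,
      ← WeierstrassCurve.Affine.Point.map_map, hQ, VariableChange.pointEquivBaseChange_map,
      map_untwist_symm_of_eq_units (D • W') hθ2 hθ hθ'2 hθ'0 j.toRatAlgHom 1 hjθ,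
      Units.val_one, one_zsmul, VariableChange.pointEquivBaseChange_map,
      descendedPoint_eq_congrEquiv_pointMap W' D C₂ d hθ'2 hθ'0]
  -- Step B: the receptacle's logarithm read in `F`, and a multiple of `Q` in the level
  obtain ⟨hlogQ, hmQ, hm⟩ :=
    map_logOmega_eq_padicLogPointFiniteExt p e he (C₂ • (D • W').quadraticTwist d) ι_p Q
  rw [hQC, ← map_nsmul, congrEquiv_mem_level_iff hCV] at hmQ
  rw [hQC, padicLogPointFiniteExt_congrEquiv hCV] at hlogQ
  -- Step C: `|u| ≥ 1` from the discriminants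
  have hu := one_le_val_u_of_smul_eq p W' D C₂ d e he hCV hΔ'
  -- Step D: the change-of-variables rule for `log_ω`
  have key := padicLogPointFiniteExt_pointMap_of_variableChange_of_one_le_of_completeSpace
    (V := W'.baseChange F) hp0' hp1' hu hm hmQ
  rw [← hlogQ, compositeChange_u (L := F) D C₂ hθ'0] at key
  -- solve for `log z`
  have hu0 : algebraMap ℚ F (C₂.u * D.u : ℚ) ≠ 0 := by
    rw [map_ne_zero]; exact mul_ne_zero C₂.u.ne_zero D.u.ne_zero
  have e1 : padicLogPointFiniteExt NormedField.valuation (W'.baseChange F) p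
        (WeierstrassCurve.Affine.Point.map j.toRatAlgHom z) =
      ((algebraMap ℚ F (C₂.u * D.u : ℚ)) * (j θ)⁻¹)⁻¹ *
        e (logOmega (C₂ • (D • W').quadraticTwist d) p ι_p Q) := by
    rw [key, ← mul_assoc, inv_mul_cancel₀ (mul_ne_zero hu0 (inv_ne_zero hθ'0)), one_mul]
  rw [e1, mul_inv, inv_inv, mul_comm (algebraMap ℚ F (C₂.u * D.u : ℚ))⁻¹]

/-- **The squared form**: `(log_{ω_{W'}} j_* z)² = d · (u_{C₂} u_D)⁻² · e(log_{ω_W} Q)²` — on the door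
(`d = p*`) the printed `(log z_χ)²` of Castella–Hsieh's value formula is `p*` times a rational unit square
times the receptacle's `(log_{ω_W} Q)²`. [cite: SilvermanAEC2009, III.1 Table 3.1 with Thm. IV.6.4 and X.5 Cor. 5.4] -/
theorem sq_padicLog_map_eq_of_descent
    {θ : L} (hθ2 : θ ^ 2 = algebraMap ℚ L d) (hθ : θ ≠ 0)
    (z : (W'.baseChange L).toAffine.Point)
    (Q : ((C₂ • (D • W').quadraticTwist d).baseChange K).toAffine.Point)
    (hQ : WeierstrassCurve.Affine.Point.map (algebraMap K L).toRatAlgHom Q =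
      VariableChange.pointEquivBaseChange ((D • W').quadraticTwist d) C₂ L
        ((VariableChange.pointEquiv (((D • W').quadraticTwist d).baseChange L) (untwistAt hθ)).symm
          ((Affine.Point.congrEquiv (untwistAt_smul_eq (D • W') hθ2 hθ)).symm
            (VariableChange.pointEquivBaseChange W' D L z))))
    (ι_p : K →+* ℚ_[p]) (e : ℚ_[p] →+* F) (he : ∀ x, ‖e x‖ = ‖x‖) (j : L →+* F)
    (hj : ∀ x : K, j (algebraMap K L x) = e (ι_p x))
    (hΔ' : ¬ (p : ℤ) ∣ minimalDiscriminantInt W') :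
    haveI := isIntegral_valuation_baseChange W' F
    (padicLogPointFiniteExt NormedField.valuation (W'.baseChange F) p
        (WeierstrassCurve.Affine.Point.map j.toRatAlgHom z)) ^ 2 =
      algebraMap ℚ F d * ((algebraMap ℚ F (C₂.u * D.u : ℚ))⁻¹) ^ 2 *
        (e (logOmega (C₂ • (D • W').quadraticTwist d) p ι_p Q)) ^ 2 := by
  have hj'app : ∀ x, j.toRatAlgHom x = j x := fun x ↦ rfl
  have hθ'2 : (j θ) ^ 2 = algebraMap ℚ F d := by
    rw [← map_pow, hθ2, ← hj'app, AlgHom.commutes]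
  rw [padicLog_map_eq_mul_logOmega_of_descent p W' D C₂ d hθ2 hθ z Q hQ ι_p e he j hj hΔ', mul_pow,
    mul_pow, hθ'2]

end Descent

end Summit.BirchSwinnertonDyer.BirchSwinnertonDyer.Theorems.SchneiderFree.KYRead.LogDescent

end
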